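import Mathlib
import Literature.Analysis.FluidPDE.KelvinCirculationProofs
import Literature.Analysis.FluidPDE.KelvinCirculationForced
import HarnessLib

/-!
# Kelvin ceiling — the kinematic half of the frozen-in budget (R8 of the ns-blowup rate table)

HONEST FRAMING (cell `ns-blowup`, seat `ns-blowup-instab` = the AUDIT seat, human ruling D-0035):
nothing here is a claim about Navier–Stokes blow-up. WHAT THIS IS NOT: not a statement about the
Palasek tower; it is the elementary inequality `|∮_γ v · dℓ| ≤ ‖v‖_∞ · Length(γ)` for the TREE's
circulation functional `Literature.Analysis.FluidPDE.circulation` (Vorticity.lean), and its composition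
with the tree's PROVED Kelvin circulation theorem
(`Literature.Analysis.FluidPDE.kelvin_circulation_theorem_holds`, KelvinCirculationProofs.lean): along
a smooth unforced Euler flow, the circulation of a transported loop at time `t₁` is bounded by
(sup of `‖u t₀‖`) × (length of the loop at time `t₀`). This is Lemma L8.3 (length form) of
`run/shared/lean/pub/ns-blowup/instab/RATE-AUDIT.md`: a level-`k` core of circulation `Γ_k` must
descend from a loop of length `≥ Γ_k / ‖u(t_k)‖_∞` — the "self-bundling" hatch stated as a necessary
geometric fact. The exponent bookkeeping that turns this into the audit's margins is the companion
file `PalasekTowerExponentLedger.lean`.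
-/

namespace Summit.NavierStokesRegularity.FluidComputer.KelvinCeiling

open MeasureTheory Set intervalIntegral
open scoped InnerProductSpace RealInnerProductSpace
open Literature.Analysis.FluidPDE

section Kinematic

variable {E : Type*} [NormedAddCommGroup E] [InnerProductSpace ℝ E]

/-- **Kelvin ceiling, kinematic half.** If `‖v‖ ≤ U` everywhere and the speed `‖γ'‖` of the
parametrised curve `γ : [0,1] → E` is interval-integrable with `∫₀¹ ‖γ'‖ ≤ L` (its length), then
`|∮_γ v · dℓ| ≤ U · L` for the tree's `circulation v γ = ∫₀¹ ⟪v (γ s), γ' s⟫ ds`.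
(Cauchy–Schwarz under the integral sign.) -/
theorem abs_circulation_le {v : E → E} {γ : ℝ → E} {U L : ℝ}
    (hU : ∀ x, ‖v x‖ ≤ U)
    (hγ : IntervalIntegrable (fun s => ‖deriv γ s‖) volume 0 1)
    (hL : ∫ s in (0:ℝ)..1, ‖deriv γ s‖ ≤ L) :
    |circulation v γ| ≤ U * L := by
  have hU0 : 0 ≤ U := le_trans (norm_nonneg _) (hU (γ 0))
  have h1 : ‖∫ s in (0:ℝ)..1, ⟪v (γ s), deriv γ s⟫_ℝ‖ ≤ ∫ s in (0:ℝ)..1, U * ‖deriv γ s‖ := by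
    refine intervalIntegral.norm_integral_le_of_norm_le zero_le_one ?_ (hγ.const_mul U)
    filter_upwards with s _
    calc ‖⟪v (γ s), deriv γ s⟫_ℝ‖ ≤ ‖v (γ s)‖ * ‖deriv γ s‖ := norm_inner_le_norm _ _
      _ ≤ U * ‖deriv γ s‖ := by gcongr; exact hU _
  have h2 : ∫ s in (0:ℝ)..1, U * ‖deriv γ s‖ = U * ∫ s in (0:ℝ)..1, ‖deriv γ s‖ :=
    intervalIntegral.integral_const_mul U _
  calc |circulation v γ| = ‖∫ s in (0:ℝ)..1, ⟪v (γ s), deriv γ s⟫_ℝ‖ := by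
        rw [Real.norm_eq_abs]; rfl
    _ ≤ U * ∫ s in (0:ℝ)..1, ‖deriv γ s‖ := h2 ▸ h1
    _ ≤ U * L := by gcongr

/-- Area-free corollary used contrapositively in the audit: a loop whose circulation exceeds
`U · L` cannot have length `≤ L` in a field bounded by `U`. -/
theorem length_lt_of_circulation_gt {v : E → E} {γ : ℝ → E} {U L : ℝ}
    (hU : ∀ x, ‖v x‖ ≤ U)
    (hγ : IntervalIntegrable (fun s => ‖deriv γ s‖) volume 0 1)
    (hΓ : U * L < |circulation v γ|) :
    L < ∫ s in (0:ℝ)..1, ‖deriv γ s‖ := by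
  by_contra h
  exact absurd (abs_circulation_le hU hγ (not_lt.mp h)) (not_le.mpr hΓ)

end Kinematic

section Euler

variable {E : Type*} [NormedAddCommGroup E] [InnerProductSpace ℝ E] [FiniteDimensional ℝ E]
variable {S : Set ℝ} {u : ℝ → E → E} {p : ℝ → E → ℝ}

/-- **Kelvin ceiling along an Euler flow** (Lemma L8.3, length form, inviscid clause (H1)).
For a smooth unforced Euler solution on `E × S` (`S` convex), a jointly smooth particle-trajectory
map `X` with `∂ₜ X = u(t, X)`, and a closed `C¹` loop `γ`: if `‖u t₀‖ ≤ U₀` everywhere and the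
transported loop `X t₀ ∘ γ` has length `≤ L₀`, then at ANY `t₁ ∈ S` the circulation of the
transported loop obeys `|∮_{X t₁ ∘ γ} u t₁ · dℓ| ≤ U₀ · L₀`. Proof: Kelvin
(`kelvin_circulation_theorem_holds`, tree, PROVED from Majda–Bertozzi Prop. 1.11) moves the
circulation to time `t₀`, then `abs_circulation_le`. Read at `t₀ = t_k`, `t₁ = t_{k+1}` this is:
the material pre-image of a level-`k` core loop of circulation `Γ_k` has length `≥ Γ_k / U₀`. -/
theorem abs_circulation_transported_le
    (h : IsClassicalEulerSolutionOn S 0 u p) (hS : Convex ℝ S)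
    {X : ℝ → E → E} (hX : IsSmoothSpaceTimeOn S X)
    (hXu : ∀ t ∈ S, ∀ a, HasDerivWithinAt (fun s => X s a) (u t (X t a)) S t)
    {γ : ℝ → E} (hγ : ContDiff ℝ 1 γ) (hloop : γ 0 = γ 1)
    {t₀ t₁ : ℝ} (ht₀ : t₀ ∈ S) (ht₁ : t₁ ∈ S)
    {U₀ L₀ : ℝ} (hU : ∀ x, ‖u t₀ x‖ ≤ U₀)
    (hγ' : IntervalIntegrable (fun s => ‖deriv (X t₀ ∘ γ) s‖) volume 0 1)
    (hL : ∫ s in (0:ℝ)..1, ‖deriv (X t₀ ∘ γ) s‖ ≤ L₀) :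
    |circulation (u t₁) (X t₁ ∘ γ)| ≤ U₀ * L₀ := by
  have hK := kelvin_circulation_theorem_holds (E := E) (S := S) (u := u) (p := p)
  rw [hK h hS hX hXu hγ hloop ht₀ ht₁]
  exact abs_circulation_le hU hγ' hL

/-- Contrapositive, the form quoted in the audit: if the circulation at time `t₁` exceeds
`U₀ · L₀`, the loop was LONGER than `L₀` at time `t₀`. -/
theorem transported_length_lt_of_circulation_gt
    (h : IsClassicalEulerSolutionOn S 0 u p) (hS : Convex ℝ S)
    {X : ℝ → E → E} (hX : IsSmoothSpaceTimeOn S X)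
    (hXu : ∀ t ∈ S, ∀ a, HasDerivWithinAt (fun s => X s a) (u t (X t a)) S t)
    {γ : ℝ → E} (hγ : ContDiff ℝ 1 γ) (hloop : γ 0 = γ 1)
    {t₀ t₁ : ℝ} (ht₀ : t₀ ∈ S) (ht₁ : t₁ ∈ S)
    {U₀ L₀ : ℝ} (hU : ∀ x, ‖u t₀ x‖ ≤ U₀)
    (hγ' : IntervalIntegrable (fun s => ‖deriv (X t₀ ∘ γ) s‖) volume 0 1)
    (hΓ : U₀ * L₀ < |circulation (u t₁) (X t₁ ∘ γ)|) :
    L₀ < ∫ s in (0:ℝ)..1, ‖deriv (X t₀ ∘ γ) s‖ := by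
  by_contra hle
  exact absurd (abs_circulation_transported_le h hS hX hXu hγ hloop ht₀ ht₁ hU hγ' (not_lt.mp hle))
    (not_le.mpr hΓ)

end Euler

section Viscous

variable {E : Type*} [NormedAddCommGroup E] [InnerProductSpace ℝ E] [FiniteDimensional ℝ E]
variable {ν : ℝ} {f u : ℝ → E → E} {p : ℝ → E → ℝ}

open scoped Laplacian

/-- **Viscous / forced Kelvin ceiling — the kernel form of Lemma L8.4 of the audit** (clauses
(H_ν), (H_f) of the planner's KELVIN-LEG KL1). For a classical solution of
`∂ₜu + (u·∇)u = νΔu − ∇p + f` on the slab `[a, b] × E` (any `ν`, any force `f`), a jointly smooth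
trajectory map `X` with `∂ₜX = u(t, X)` and a closed `C¹` loop `γ`: if the loop integral of
`νΔu(t) + f(t)` around the transported loop is bounded by `B t` with `B` integrable, then
`|Γ(b) − Γ(a)| ≤ ∫ₐᵇ B`. This is `IsClassicalNSSolutionOn.circulation_sub_eq_integral`
(KelvinCirculationForced.lean, lit seat, W12: `Γ(b) − Γ(a) = ∫ₐᵇ ∮_{C(t)} (νΔu + f)·dℓ dt`)
followed by the triangle inequality for the time integral. -/
theorem abs_circulation_sub_le_integral {a b : ℝ} (hab : a < b)
    (h : IsClassicalNSSolutionOn (Icc a b) ν f u p)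
    {X : ℝ → E → E} (hX : IsSmoothSpaceTimeOn (Icc a b) X)
    (hXu : ∀ t ∈ Icc a b, ∀ y, HasDerivWithinAt (fun s => X s y) (u t (X t y)) (Icc a b) t)
    {γ : ℝ → E} (hγ : ContDiff ℝ 1 γ) (hloop : γ 0 = γ 1)
    {B : ℝ → ℝ}
    (hB : ∀ t ∈ Icc a b, |circulation (fun x => ν • Δ (u t) x + f t x) (X t ∘ γ)| ≤ B t)
    (hBi : IntervalIntegrable B volume a b) :
    |circulation (u b) (X b ∘ γ) - circulation (u a) (X a ∘ γ)| ≤ ∫ t in a..b, B t := by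
  rw [h.circulation_sub_eq_integral hab hX hXu hγ hloop, ← Real.norm_eq_abs]
  refine intervalIntegral.norm_integral_le_of_norm_le hab.le ?_ hBi
  filter_upwards with t ht
  rw [Real.norm_eq_abs]
  exact hB t (Ioc_subset_Icc_self ht)

/-- **Viscous / forced Kelvin ceiling, pointwise form** (L8.4 as quoted in RATE-AUDIT §1): with
`‖νΔu(t) + f(t)‖ ≤ G t` everywhere and the transported loop of length `≤ L t`,
`|Γ(b) − Γ(a)| ≤ ∫ₐᵇ G·L` — "viscous and force corrections to a level's circulation are bounded by
(sup of `|ν|‖Δu‖ + ‖f‖`) × (loop length), integrated over the window". The kinematic step is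
`abs_circulation_le` of this file. -/
theorem abs_circulation_sub_le_integral_mul {a b : ℝ} (hab : a < b)
    (h : IsClassicalNSSolutionOn (Icc a b) ν f u p)
    {X : ℝ → E → E} (hX : IsSmoothSpaceTimeOn (Icc a b) X)
    (hXu : ∀ t ∈ Icc a b, ∀ y, HasDerivWithinAt (fun s => X s y) (u t (X t y)) (Icc a b) t)
    {γ : ℝ → E} (hγ : ContDiff ℝ 1 γ) (hloop : γ 0 = γ 1)
    {G L : ℝ → ℝ}
    (hG : ∀ t ∈ Icc a b, ∀ x, ‖ν • Δ (u t) x + f t x‖ ≤ G t)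
    (hγ' : ∀ t ∈ Icc a b, IntervalIntegrable (fun s => ‖deriv (X t ∘ γ) s‖) volume 0 1)
    (hL : ∀ t ∈ Icc a b, ∫ s in (0:ℝ)..1, ‖deriv (X t ∘ γ) s‖ ≤ L t)
    (hGLi : IntervalIntegrable (fun t => G t * L t) volume a b) :
    |circulation (u b) (X b ∘ γ) - circulation (u a) (X a ∘ γ)| ≤ ∫ t in a..b, G t * L t :=
  abs_circulation_sub_le_integral hab h hX hXu hγ hloop
    (fun t ht => abs_circulation_le (hG t ht) (hγ' t ht) (hL t ht)) hGLi

/-- Unforced, inviscid sanity check: for `ν = 0`, `f = 0` the bound may be taken `B = 0`, and the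
circulation of the transported loop is conserved up to sign of nothing — `|Γ(b) − Γ(a)| ≤ 0`
(Kelvin's theorem recovered as an inequality). -/
theorem abs_circulation_sub_le_zero {a b : ℝ} (hab : a < b)
    (h : IsClassicalNSSolutionOn (Icc a b) 0 0 u p)
    {X : ℝ → E → E} (hX : IsSmoothSpaceTimeOn (Icc a b) X)
    (hXu : ∀ t ∈ Icc a b, ∀ y, HasDerivWithinAt (fun s => X s y) (u t (X t y)) (Icc a b) t)
    {γ : ℝ → E} (hγ : ContDiff ℝ 1 γ) (hloop : γ 0 = γ 1) :
    |circulation (u b) (X b ∘ γ) - circulation (u a) (X a ∘ γ)| ≤ 0 := by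
  have h0 : ∀ t ∈ Icc a b,
      |circulation (fun x => (0:ℝ) • Δ (u t) x + (0 : ℝ → E → E) t x) (X t ∘ γ)| ≤ (fun _ => (0:ℝ)) t := by
    intro t _
    have : (fun x => (0:ℝ) • Δ (u t) x + (0 : ℝ → E → E) t x) = (0 : E → E) := by
      funext x; simp
    rw [this, circulation_zero_left, abs_zero]
  simpa using abs_circulation_sub_le_integral hab h hX hXu hγ hloop h0
    (intervalIntegrable_const : IntervalIntegrable (fun _ : ℝ => (0:ℝ)) volume a b)

end Viscous

end Summit.NavierStokesRegularity.FluidComputer.KelvinCeiling
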